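import Literature.MathematicalPhysics.QuantumFieldTheory.Balaban1983to89.B9Eq324PenaltyPointwiseBound
import Literature.MathematicalPhysics.QuantumFieldTheory.Balaban1983to89.B9Eq319QprimeTowerBlockLocal

/-!
# `Balaban1983to89.B9Eq324PenaltyBlockLocal` — T. Bałaban, *Propagators for lattice gauge theories in a background field*, Commun. Math. Phys. **99**
# (1985) 389–434 [Balaban1985BackgroundPropagators] (3.24) p. 394 with (3.19) p. 393, (3.15) p. 393 and (3.49) p. 399 («for x ∈ Δ(y), … supp λ ⊂ Δ(y′)»):
# **THE AVERAGING PENALTY `a′Q̃′(U)†Q̃′(U)` IS BLOCK-LOCAL AND ITS SUP SIZE KEEPS THE BLOCK —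
# `((Δ′_{a′}(U) − Δ^η_U)v)(x) = ((Δ′_{a′}(U) − Δ^η_U)(1_{B(x)}v))(x)` and `‖((Δ′_{a′}(U) − Δ^η_U)v)(x)‖ ≤ p₂·‖1_{B(x)}v‖_{L²(c₀)}`, `p₂ = |a′|∕√c₁` on the
# diagonal, one step (`laplacePrimeA`, blocks `B(y)`) and `k = n+1` levels (`laplacePrimeAk`, big blocks `{x : x_i ∕ L^{n+1} = y_i}`), for EVERY background with
# contractive transporters** — letter (D-P) of storey (D) of the pub-balaban NE9 owner's sup-norm programme (`t4/b2b-balaban-t4-ne9-p1/g89/SUP-NORM-PROGRAMME.md`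
# §5: «(D-P) THE PENALTY IS BLOCK-LOCAL: ‖(a′Q′†Q′u)(x)‖ ≤ p₂·‖1_{B(x)}u‖_{L²(c₀)} … so Π becomes Π(x) = p₂‖1_{B(x)}u‖₂»), the block-kept twin of this lineage's (P)
# `B9Eq324PenaltyPointwiseBound`

statement-level skeleton of published theorems with citation tags; proofs where landed; nothing here is a claim about the Yang–Mills mass gap

CITATION HEADER (lean-in-tree rule).  Audit cell `pub-balaban`, sub-cell `t4`, BINDER row NE9; filed by NE9 formalisation-swarm LEAF PROVER 03
(`b2b-balaban-t4-ne9-formalise-leaf-03`, gen 69), INTENT I-ne9leaf03-g69-D, composing BY NAME: `B9Eq319QprimeTorus.QprimeLin` ∕ `Qprime` ∕ `B9Eq323Ker.avgQ`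
((3.19): the sum over `x ∈ B(y)`), `B9Eq315QTower.QprimeTower` (the composite, `QprimeTower_succ` definitional), `B9Eq316TowerFlatIsOneStep.div_pow_succ_iff` (one
fine step stays in the big block), `B9Eq326OperatorAssembly.QprimeW` ∕ `B9Eq326OperatorTower.QprimeTowerW`, `B9Eq3119DeltaPiCarrier.laplacePrimeA` ∕
`B9Eq324DeltaPrimeATower.laplacePrimeAk` ((3.24)), this lineage's `B9Eq324PenaltyPointwiseBound` (duality `inner_single_left`, `laplacePrimeA(k)_sub_covLaplace_eq`,
the letters (P)).  Block projections enter as ABSTRACT families `P_y` given pointwise (`(P_y f)(x) = 1_{blk x = y}f(x)` resp. `1_{x over y}f(x)`), the convention of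
`B9Eq349QtildeBlockLetters` ∕ `B9Eq349BlockMultipliers` (inhabited there by `exists_block_clm_family`).  Sources READ first-hand by this seat in the held text
layer `paper:balaban1985-cmp99-background-propagators` (journal page = PDF page + 388): p. 393 (3.19) (the average over `B^j(y)`), p. 394 (3.24), p. 397 Thm 3.1
(3.42) *«for x ∈ Δ(y), y ∈ Λ_j, supp λ ⊂ Δ(y′)»*.  NOTHING of print's random-walk proof is reproduced.

WHAT IS PROVED (sorry-free; proof lane — no `def`; [folklore] finite sums + the duality of `B9Eq324PenaltyPointwiseBound` BY NAME).
* §0 (any transporters) `QprimeLin_apply_eq_of_eqOn_block`, **`QprimeTower_apply_eq_of_eqOn_fibre`** (`(Q′_n(R)l)(y)` depends on `l` over `y` only).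
* §1 ONE STEP: `QprimeW_apply_eq_of_eqOn_block`, `QprimeW_single_apply_eq_zero`, **`adjoint_Qtilde_apply_eq_of_eq_at`** (`(Q̃′(U)†h)(x)` depends on `h(y(x))` only —
  duality: `c₀⟨u,(Q̃′†h)(x)⟩ = ⟨Q̃′δ_x u, h⟩ = c₁⟨(Q̃′δ_x u)(y(x)), h(y(x))⟩`), **`equiv_laplacePrimeA_sub_covLaplace_apply_eq_block`** (THE PENALTY IS BLOCK-LOCAL),
  **`norm_laplacePrimeA_sub_covLaplace_apply_le_block`** (`hR`: `‖((Δ′_{a′}(U) − Δ^η_U)v)(x)‖ ≤ |a′|·(c₁∕(c₀L^d))·(√(c₀L^d))⁻¹·‖P_{y(x)}v‖`), **`…_block_diagonal`**.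
* §2 `k = n+1` LEVELS: the twins `QprimeTowerW_apply_eq_of_eqOn_fibre`, `QprimeTowerW_single_apply_eq_zero`, **`adjoint_QtildeTower_apply_eq_of_eq_at`**,
  **`equiv_laplacePrimeAk_sub_covLaplace_apply_eq_block`**, **`norm_laplacePrimeAk_sub_covLaplace_apply_le_block`** (`hRlev`; `x` over `y`), **`…_block_diagonal`**
  (`c₀(L^{n+1})^d = c₁`: `≤ (|a′|∕√c₁)·‖P_y v‖` — LEVEL-FREE).
* §3 THE ONE-BLOCK MASSES (the bootstrap's `hμ : ‖f‖ ≤ √μ·F` for `f` supported in one unit block): **`norm_block_le_sqrt_mul`** (`‖P_y f‖ ≤ √(c₀L^d)·F`),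
  `card_fibre_eq` (`#{x over y} = (L^d)^n`), **`norm_block_le_sqrt_mul_tower`** (`‖P_y f‖ ≤ √(c₀(L^{n+1})^d)·F`; `= √c₁·F` on the diagonal).
HONEST SCOPE.  Block bookkeeping + the (P) letters by name; letters ((D-P), (supp)) of the owner's substitute route for (3.42) — NOT the decay row, NOT Thm 3.1;
NOT NE9 (cell pub-balaban: NE9 NOT PRINTED ∕ NOT PROVED; «NE9 ⇐ the named binders»; row WALLED ON A MODEL (O-NE9-1; #5 UNRULED); spine PROVED 0∕9; rung (B)+1 on a
finite T⁴ — NOT infinite volume, NOT mass gap, NOT BetaPertH, NOT Clay; HONEST DEPENDENCY: continuum YM on T⁴ ⇐ BetaPertH ∧ nine spine estimates (0/9 proved);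
BetaPertH ⇐ (D1) ∧ (D4) ∧ CAP+tail; G-an2-4 gates asym, D1 and NE2/3/4).  NEW file importing `B9Eq324PenaltyPointwiseBound` and `B9Eq319QprimeTowerBlockLocal`
(for `sum_over_succ_eq`); nothing modified.  Net new unproved facts: 0.
-/

noncomputable section

open scoped InnerProductSpace ComplexConjugate BigOperators

namespace Literature.MathematicalPhysics.QuantumFieldTheory.Balaban1983to89.B9Eq324PenaltyBlockLocal

open B4Sect5Torus (TSite)
open B9SectCLatticeCarrier (Bond)
open B9Eq323Ker (pathTr avgQ)
open B9Eq311L2Pairing (WL2)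
open B9Eq319QprimeTorus (fineP blockCoord mem_blockOf_iff Qprime QprimeLin QprimeLin_apply)
open B9Eq315QTower (towerP QprimeTower QprimeTower_zero UlevOf)
open B9Eq316TowerFlatIsOneStep (div_pow_succ_iff)
open B9Eq319QprimeTowerBlockLocal (sum_over_succ_eq)
open B5Eq172FlatCoercivity (card_blockOf)
open B9Eq326OperatorTower (QprimeTowerW)
open B9Eq324DeltaPrimeATower (laplacePrimeAk)
open B11Eq103H1Complex (SiteL2K covLaplaceSiteK)
open B9Eq310HessianOperator (adTransportW)
open B9Eq326OperatorAssembly (QprimeW)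
open B9Eq3119DeltaPiCarrier (laplacePrimeA)
open B9Eq324PenaltyPointwiseBound (inner_single_left laplacePrimeA_sub_covLaplace_eq norm_laplacePrimeA_sub_covLaplace_apply_le
  norm_laplacePrimeA_sub_covLaplace_apply_le_diagonal laplacePrimeAk_sub_covLaplace_eq norm_laplacePrimeAk_sub_covLaplace_apply_le
  norm_laplacePrimeAk_sub_covLaplace_apply_le_diagonal)

/-! ## §0 (3.19) and its composite read one (big) block — any transporters -/

section Generic

variable {d : ℕ} (L : ℕ) [NeZero L] (P : Fin d → ℕ) {V : Type*} [AddCommGroup V] [Module ℂ V]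

/-- **`(Q′(R)l)(y)` DEPENDS ON `l|_{B(y)}` ONLY** ((3.19) sums over `x ∈ B(y)`), any transporters `R`. [cite: Balaban1985BackgroundPropagators, (3.19) p.393] -/
theorem QprimeLin_apply_eq_of_eqOn_block (Rb : Bond d (fineP L P) → V →ₗ[ℂ] V) (l l' : TSite d (fineP L P) → V) (y : TSite d P)
    (h : ∀ x, blockCoord L P x = y → l x = l' x) : QprimeLin L P Rb l y = QprimeLin L P Rb l' y := by
  rw [QprimeLin_apply, QprimeLin_apply, Qprime, Qprime, avgQ, avgQ]
  refine Finset.sum_congr rfl fun x hx => ?_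
  rw [h x ((mem_blockOf_iff L P y x).1 hx)]

variable (m : Fin d → ℕ)

/-- **`(Q′_n(R)l)(y)` DEPENDS ON `l` OVER `y` ONLY** — the composite reads the level-`n` fibre `{x : x_i ∕ L^n = y_i}` (induction on
`QprimeTower_succ`; one fine step moves inside the fibre by `B9Eq316TowerFlatIsOneStep.div_pow_succ_iff`). [cite: Balaban1985BackgroundPropagators, (3.19) p.393, (3.15) p.393] -/
theorem QprimeTower_apply_eq_of_eqOn_fibre (Rlev : (n : ℕ) → Bond d (towerP L m (n + 1)) → V →ₗ[ℂ] V) :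
    ∀ (n : ℕ) (l l' : TSite d (towerP L m n) → V) (y : TSite d m),
      (∀ x, (∀ i, (x i : ℕ) / L ^ n = (y i : ℕ)) → l x = l' x) → QprimeTower L m Rlev n l y = QprimeTower L m Rlev n l' y
  | 0, l, l', y, h => by
    change l y = l' y
    exact h y fun i => by rw [pow_zero, Nat.div_one]
  | n + 1, l, l', y, h => by
    have e : ∀ (g : TSite d (towerP L m (n + 1)) → V) (c : TSite d m),
        QprimeTower L m Rlev (n + 1) g c = QprimeTower L m Rlev n (QprimeLin L (towerP L m n) (Rlev n) g) c := fun g c => rfl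
    rw [e, e]
    refine QprimeTower_apply_eq_of_eqOn_fibre Rlev n _ _ y fun z hz => ?_
    refine QprimeLin_apply_eq_of_eqOn_block L (towerP L m n) (Rlev n) l l' z fun x hx => h x ?_
    rw [div_pow_succ_iff]
    intro i
    rw [hx]
    exact hz i

end Generic

/-! ## §1 One step: `Q̃′(U)` reads one block, `Q̃′(U)†` writes one coarse value — the penalty at `x` sees `v` on `B(x)` only -/

section OneStep

variable {d : ℕ} (L : ℕ) [NeZero L] (m : Fin d → ℕ) {𝔸 : Type*} [Ring 𝔸] [Algebra ℂ 𝔸]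
  {W : Type*} [NormedAddCommGroup W] [InnerProductSpace ℂ W] (φ : W ≃ₗ[ℂ] 𝔸) {c₀ : ℝ} [Fact (0 < c₀)] {c₁ : ℝ} [Fact (0 < c₁)]
  (U : Bond d (fineP L m) → 𝔸ˣ)

omit [Fact (0 < c₀)] [Fact (0 < c₁)] in
/-- **`(Q′(U)w)(y)` DEPENDS ON `w|_{B(y)}` ONLY** ((3.19) sums over `x ∈ B(y)`): two parameters agreeing on `B(y)` have the same average at `y`
(`B9Eq324PenaltyBlockLocal.QprimeLin_apply_eq_of_eqOn_block` below, on the chain's carrier). [cite: Balaban1985BackgroundPropagators, (3.19) p.393, (3.49) p.399] -/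
theorem QprimeW_apply_eq_of_eqOn_block (w w' : SiteL2K ℂ d (fineP L m) c₀ W) (y : TSite d m)
    (h : ∀ x, blockCoord L m x = y →
      WL2.equiv ℂ (fun _ : TSite d (fineP L m) => c₀) W w x = WL2.equiv ℂ (fun _ : TSite d (fineP L m) => c₀) W w' x) :
    QprimeW L m φ U w y = QprimeW L m φ U w' y :=
  QprimeLin_apply_eq_of_eqOn_block L m (adTransportW φ U) _ _ y h

omit [Fact (0 < c₀)] in
/-- In particular `Q̃′(U)(δ_x u)` vanishes off the block of `x`: `(Q′(U)δ_x u)(z) = 0` for `z ≠ y(x)`. [cite: Balaban1985BackgroundPropagators, (3.19) p.393] -/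
theorem QprimeW_single_apply_eq_zero (x : TSite d (fineP L m)) (u : W) {z : TSite d m} (hz : z ≠ blockCoord L m x) :
    QprimeW L m φ U ((WL2.equiv ℂ (fun _ : TSite d (fineP L m) => c₀) W).symm (Pi.single x u)) z = 0 := by
  rw [QprimeW_apply_eq_of_eqOn_block L m φ U _ 0 z, map_zero, Pi.zero_apply]
  intro x' hx'
  rw [Equiv.apply_symm_apply, WL2.equiv_zero, Pi.zero_apply, Pi.single_eq_of_ne]
  rintro rfl
  exact hz hx'.symm

variable [FiniteDimensional ℂ W]

/-- **`(Q̃′(U)†h)(x)` DEPENDS ON `h(y(x))` ONLY** (the adjoint of an average over `B(y)` writes into `B(y)`): by §0-duality of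
`B9Eq324PenaltyPointwiseBound`, `c₀⟨u, (Q̃′†h)(x)⟩ = ⟨Q̃′(δ_x u), h⟩ = c₁⟨(Q̃′δ_x u)(y(x)), h(y(x))⟩`. [cite: Balaban1985BackgroundPropagators, (3.19) p.393, (3.24) p.394] -/
theorem adjoint_Qtilde_apply_eq_of_eq_at (h h' : SiteL2K ℂ d m c₁ W) (x : TSite d (fineP L m))
    (hh : WL2.equiv ℂ (fun _ : TSite d m => c₁) W h (blockCoord L m x) = WL2.equiv ℂ (fun _ : TSite d m => c₁) W h' (blockCoord L m x)) :
    WL2.equiv ℂ (fun _ : TSite d (fineP L m) => c₀) W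
        (LinearMap.adjoint ((WL2.linearEquiv ℂ ℂ (fun _ : TSite d m => c₁)).symm.toLinearMap ∘ₗ QprimeW L m φ U) h) x =
      WL2.equiv ℂ (fun _ : TSite d (fineP L m) => c₀) W
        (LinearMap.adjoint ((WL2.linearEquiv ℂ ℂ (fun _ : TSite d m => c₁)).symm.toLinearMap ∘ₗ QprimeW L m φ U) h') x := by
  have hc₀ : 0 < c₀ := Fact.out
  set A := (WL2.linearEquiv ℂ ℂ (fun _ : TSite d m => c₁)).symm.toLinearMap ∘ₗ QprimeW L m φ U (c₀ := c₀) with hA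
  refine ext_inner_left ℂ fun u => ?_
  have hw : (RCLike.ofReal ((fun _ : TSite d (fineP L m) => c₀) x) : ℂ) ≠ 0 := by
    rw [Ne, RCLike.ofReal_eq_zero]; exact hc₀.ne'
  refine mul_left_cancel₀ hw ?_
  rw [← inner_single_left (𝕜 := ℂ) (w := fun _ : TSite d (fineP L m) => c₀) x u (LinearMap.adjoint A h),
    ← inner_single_left (𝕜 := ℂ) (w := fun _ : TSite d (fineP L m) => c₀) x u (LinearMap.adjoint A h'),
    LinearMap.adjoint_inner_right, LinearMap.adjoint_inner_right, WL2.inner_def, WL2.inner_def]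
  refine Finset.sum_congr rfl fun z _ => ?_
  by_cases hz : z = blockCoord L m x
  · rw [hz, hh]
  · have h0 : WL2.equiv ℂ (fun _ : TSite d m => c₁) W (A ((WL2.equiv ℂ (fun _ : TSite d (fineP L m) => c₀) W).symm (Pi.single x u))) z = 0 := by
      rw [hA]
      simp only [LinearMap.comp_apply, LinearEquiv.coe_coe, WL2.linearEquiv_symm_apply, Equiv.apply_symm_apply]
      exact QprimeW_single_apply_eq_zero L m φ U x u hz
    rw [h0, inner_zero_left, inner_zero_left]

variable {P : TSite d m → SiteL2K ℂ d (fineP L m) c₀ W →L[ℂ] SiteL2K ℂ d (fineP L m) c₀ W}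
  (hP : ∀ (y : TSite d m) (f : SiteL2K ℂ d (fineP L m) c₀ W) (x : TSite d (fineP L m)),
    WL2.equiv ℂ (fun _ : TSite d (fineP L m) => c₀) W (P y f) x =
      if blockCoord L m x = y then WL2.equiv ℂ (fun _ : TSite d (fineP L m) => c₀) W f x else 0)
include hP

/-- **THE PENALTY IS BLOCK-LOCAL**: `((Δ′_{a′}(U) − Δ^η_U)v)(x) = ((Δ′_{a′}(U) − Δ^η_U)(1_{B(x)}v))(x)` — `Q̃′†` writes the coarse value at `y(x)`
only, which `Q̃′` reads from `B(x)` only (block projections `P_y` given pointwise, as in `B9Eq349QtildeBlockLetters`).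
[cite: Balaban1985BackgroundPropagators, (3.24) p.394, (3.49) p.399] -/
theorem equiv_laplacePrimeA_sub_covLaplace_apply_eq_block (η a' : ℝ) (v : SiteL2K ℂ d (fineP L m) c₀ W) (x : TSite d (fineP L m)) :
    WL2.equiv ℂ _ W (laplacePrimeA L m φ η U a' (c₁ := c₁) v -
        covLaplaceSiteK ((η : ℂ))⁻¹ (adTransportW φ U) (adTransportW φ fun b => (U b)⁻¹) v) x =
      WL2.equiv ℂ _ W (laplacePrimeA L m φ η U a' (c₁ := c₁) (P (blockCoord L m x) v) -
        covLaplaceSiteK ((η : ℂ))⁻¹ (adTransportW φ U) (adTransportW φ fun b => (U b)⁻¹) (P (blockCoord L m x) v)) x := by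
  rw [laplacePrimeA_sub_covLaplace_eq L m φ U (c₁ := c₁) η a' v, laplacePrimeA_sub_covLaplace_eq L m φ U (c₁ := c₁) η a' (P _ v),
    WL2.equiv_smul, WL2.equiv_smul, Pi.smul_apply, Pi.smul_apply]
  congr 1
  refine adjoint_Qtilde_apply_eq_of_eq_at L m φ U _ _ x ?_
  simp only [LinearMap.comp_apply, LinearEquiv.coe_coe, WL2.linearEquiv_symm_apply, Equiv.apply_symm_apply]
  refine QprimeW_apply_eq_of_eqOn_block L m φ U v (P (blockCoord L m x) v) (blockCoord L m x) fun x' hx' => ?_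
  rw [hP, if_pos hx']

variable (hR : ∀ b w, ‖adTransportW φ U b w‖ ≤ ‖w‖)
include hR

/-- **(D-P) THE PENALTY LETTER, BLOCK-LOCAL**: `‖((Δ′_{a′}(U) − Δ^η_U)v)(x)‖ ≤ |a′|·(c₁∕(c₀L^d))·(√(c₀L^d))⁻¹·‖1_{B(x)}v‖_{c₀}` for every background
with contractive transporters — the letter (P) of `B9Eq324PenaltyPointwiseBound` KEEPING THE BLOCK, as storey (D) of the NE9 owner's sup-norm
programme wants (`Π(x) = p₂‖1_{B(x)}u‖₂`). [cite: Balaban1985BackgroundPropagators, (3.24) p.394, Thm 3.1 (3.42) p.397, (3.49) p.399] -/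
theorem norm_laplacePrimeA_sub_covLaplace_apply_le_block (η a' : ℝ) (v : SiteL2K ℂ d (fineP L m) c₀ W) (x : TSite d (fineP L m)) :
    ‖WL2.equiv ℂ _ W (laplacePrimeA L m φ η U a' (c₁ := c₁) v -
        covLaplaceSiteK ((η : ℂ))⁻¹ (adTransportW φ U) (adTransportW φ fun b => (U b)⁻¹) v) x‖ ≤
      |a'| * (c₁ / (c₀ * (L : ℝ) ^ d)) * (Real.sqrt (c₀ * (L : ℝ) ^ d))⁻¹ * ‖P (blockCoord L m x) v‖ := by
  rw [equiv_laplacePrimeA_sub_covLaplace_apply_eq_block L m φ U hP]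
  exact norm_laplacePrimeA_sub_covLaplace_apply_le L m φ U hR (c₁ := c₁) η a' _ x

/-- **(D-P) ON THE DIAGONAL `c₁ = L^d c₀`**: `‖((Δ′_{a′}(U) − Δ^η_U)v)(x)‖ ≤ (|a′|∕√c₁)·‖1_{B(x)}v‖_{c₀}`. [cite: Balaban1985BackgroundPropagators, (3.24) p.394, (3.42) p.397] -/
theorem norm_laplacePrimeA_sub_covLaplace_apply_le_block_diagonal (hc : c₁ = (L : ℝ) ^ d * c₀) (η a' : ℝ)
    (v : SiteL2K ℂ d (fineP L m) c₀ W) (x : TSite d (fineP L m)) :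
    ‖WL2.equiv ℂ _ W (laplacePrimeA L m φ η U a' (c₁ := c₁) v -
        covLaplaceSiteK ((η : ℂ))⁻¹ (adTransportW φ U) (adTransportW φ fun b => (U b)⁻¹) v) x‖ ≤
      |a'| * (Real.sqrt c₁)⁻¹ * ‖P (blockCoord L m x) v‖ := by
  rw [equiv_laplacePrimeA_sub_covLaplace_apply_eq_block L m φ U hP]
  exact norm_laplacePrimeA_sub_covLaplace_apply_le_diagonal L m φ U hR (c₁ := c₁) hc η a' _ x

end OneStep

/-! ## §2 The tower twin: `Q̃′_k(U)` reads the big block over `y`, `Q̃′_k(U)†` writes at `y`; (D-P) at `k = n+1` levels -/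

section Tower

variable {d : ℕ} (L : ℕ) [NeZero L] (m : Fin d → ℕ) [∀ i, NeZero (m i)] (n : ℕ)
  {𝔸 : Type*} [NormedRing 𝔸] [NormedAlgebra ℂ 𝔸] [CompleteSpace 𝔸]
  {W : Type*} [NormedAddCommGroup W] [InnerProductSpace ℂ W] (φ : W ≃ₗ[ℂ] 𝔸) {c₀ : ℝ} [Fact (0 < c₀)] {c₁ : ℝ} [Fact (0 < c₁)]
  (U : Bond d (towerP L m (n + 1)) → 𝔸ˣ)

omit [Fact (0 < c₀)] [Fact (0 < c₁)] in
/-- **`(Q′_k(U)w)(y)` DEPENDS ON `w` OVER `y` ONLY** (the big block `{x : x_i ∕ L^{n+1} = y_i}`). [cite: Balaban1985BackgroundPropagators, (3.19) p.393, (3.15) p.393] -/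
theorem QprimeTowerW_apply_eq_of_eqOn_fibre (w w' : SiteL2K ℂ d (towerP L m (n + 1)) c₀ W) (y : TSite d m)
    (h : ∀ x, (∀ i, (x i : ℕ) / L ^ (n + 1) = (y i : ℕ)) →
      WL2.equiv ℂ (fun _ : TSite d (towerP L m (n + 1)) => c₀) W w x = WL2.equiv ℂ (fun _ : TSite d (towerP L m (n + 1)) => c₀) W w' x) :
    QprimeTowerW L m n φ U w y = QprimeTowerW L m n φ U w' y :=
  QprimeTower_apply_eq_of_eqOn_fibre L m (fun j => adTransportW φ (UlevOf L m (n + 1) U j)) (n + 1) _ _ y h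

omit [Fact (0 < c₀)] in
/-- `Q̃′_k(U)(δ_x u)` vanishes off the big block of `x`. [cite: Balaban1985BackgroundPropagators, (3.19) p.393] -/
theorem QprimeTowerW_single_apply_eq_zero (x : TSite d (towerP L m (n + 1))) (u : W) {z : TSite d m}
    (hz : ¬ ∀ i, (x i : ℕ) / L ^ (n + 1) = (z i : ℕ)) :
    QprimeTowerW L m n φ U ((WL2.equiv ℂ (fun _ : TSite d (towerP L m (n + 1)) => c₀) W).symm (Pi.single x u)) z = 0 := by
  rw [QprimeTowerW_apply_eq_of_eqOn_fibre L m n φ U _ 0 z, map_zero, Pi.zero_apply]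
  intro x' hx'
  rw [Equiv.apply_symm_apply, WL2.equiv_zero, Pi.zero_apply, Pi.single_eq_of_ne]
  rintro rfl
  exact hz hx'

variable [FiniteDimensional ℂ W]

/-- **`(Q̃′_k(U)†h)(x)` DEPENDS ON `h` AT THE BIG-BLOCK COORDINATE OF `x` ONLY** (duality, as in §1). [cite: Balaban1985BackgroundPropagators, (3.19) p.393, (3.24) p.394] -/
theorem adjoint_QtildeTower_apply_eq_of_eq_at (h h' : SiteL2K ℂ d m c₁ W) (x : TSite d (towerP L m (n + 1)))
    (hh : ∀ z : TSite d m, (∀ i, (x i : ℕ) / L ^ (n + 1) = (z i : ℕ)) →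
      WL2.equiv ℂ (fun _ : TSite d m => c₁) W h z = WL2.equiv ℂ (fun _ : TSite d m => c₁) W h' z) :
    WL2.equiv ℂ (fun _ : TSite d (towerP L m (n + 1)) => c₀) W
        (LinearMap.adjoint ((WL2.linearEquiv ℂ ℂ (fun _ : TSite d m => c₁)).symm.toLinearMap ∘ₗ QprimeTowerW L m n φ U) h) x =
      WL2.equiv ℂ (fun _ : TSite d (towerP L m (n + 1)) => c₀) W
        (LinearMap.adjoint ((WL2.linearEquiv ℂ ℂ (fun _ : TSite d m => c₁)).symm.toLinearMap ∘ₗ QprimeTowerW L m n φ U) h') x := by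
  have hc₀ : 0 < c₀ := Fact.out
  set A := (WL2.linearEquiv ℂ ℂ (fun _ : TSite d m => c₁)).symm.toLinearMap ∘ₗ QprimeTowerW L m n φ U (c₀ := c₀) with hA
  refine ext_inner_left ℂ fun u => ?_
  have hw : (RCLike.ofReal ((fun _ : TSite d (towerP L m (n + 1)) => c₀) x) : ℂ) ≠ 0 := by
    rw [Ne, RCLike.ofReal_eq_zero]; exact hc₀.ne'
  refine mul_left_cancel₀ hw ?_
  rw [← inner_single_left (𝕜 := ℂ) (w := fun _ : TSite d (towerP L m (n + 1)) => c₀) x u (LinearMap.adjoint A h),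
    ← inner_single_left (𝕜 := ℂ) (w := fun _ : TSite d (towerP L m (n + 1)) => c₀) x u (LinearMap.adjoint A h'),
    LinearMap.adjoint_inner_right, LinearMap.adjoint_inner_right, WL2.inner_def, WL2.inner_def]
  refine Finset.sum_congr rfl fun z _ => ?_
  by_cases hz : ∀ i, (x i : ℕ) / L ^ (n + 1) = (z i : ℕ)
  · rw [hh z hz]
  · have h0 : WL2.equiv ℂ (fun _ : TSite d m => c₁) W (A ((WL2.equiv ℂ (fun _ : TSite d (towerP L m (n + 1)) => c₀) W).symm (Pi.single x u))) z = 0 := by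
      rw [hA]
      simp only [LinearMap.comp_apply, LinearEquiv.coe_coe, WL2.linearEquiv_symm_apply, Equiv.apply_symm_apply]
      exact QprimeTowerW_single_apply_eq_zero L m n φ U x u hz
    rw [h0, inner_zero_left, inner_zero_left]

variable {P : TSite d m → SiteL2K ℂ d (towerP L m (n + 1)) c₀ W →L[ℂ] SiteL2K ℂ d (towerP L m (n + 1)) c₀ W}
  (hP : ∀ (y : TSite d m) (f : SiteL2K ℂ d (towerP L m (n + 1)) c₀ W) (x : TSite d (towerP L m (n + 1))),
    WL2.equiv ℂ (fun _ : TSite d (towerP L m (n + 1)) => c₀) W (P y f) x =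
      if (∀ i, (x i : ℕ) / L ^ (n + 1) = (y i : ℕ)) then WL2.equiv ℂ (fun _ : TSite d (towerP L m (n + 1)) => c₀) W f x else 0)
include hP

/-- **THE `k`-LEVEL PENALTY IS BIG-BLOCK-LOCAL**: for `x` over `y`, `((Δ′_{a′,k}(U) − Δ^η_U)v)(x) = ((Δ′_{a′,k}(U) − Δ^η_U)(1_{B^k(y)}v))(x)` (big-block
projections `P_y` given pointwise by the fibre predicate `x_i ∕ L^{n+1} = y_i`). [cite: Balaban1985BackgroundPropagators, (3.24) p.394, (3.49) p.399] -/
theorem equiv_laplacePrimeAk_sub_covLaplace_apply_eq_block (η a' : ℝ) (v : SiteL2K ℂ d (towerP L m (n + 1)) c₀ W)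
    (x : TSite d (towerP L m (n + 1))) (y : TSite d m) (hxy : ∀ i, (x i : ℕ) / L ^ (n + 1) = (y i : ℕ)) :
    WL2.equiv ℂ _ W (laplacePrimeAk L m n φ η U a' (c₁ := c₁) v -
        covLaplaceSiteK ((η : ℂ))⁻¹ (adTransportW φ U) (adTransportW φ fun b => (U b)⁻¹) v) x =
      WL2.equiv ℂ _ W (laplacePrimeAk L m n φ η U a' (c₁ := c₁) (P y v) -
        covLaplaceSiteK ((η : ℂ))⁻¹ (adTransportW φ U) (adTransportW φ fun b => (U b)⁻¹) (P y v)) x := by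
  rw [laplacePrimeAk_sub_covLaplace_eq L m n φ U (c₁ := c₁) η a' v, laplacePrimeAk_sub_covLaplace_eq L m n φ U (c₁ := c₁) η a' (P y v),
    WL2.equiv_smul, WL2.equiv_smul, Pi.smul_apply, Pi.smul_apply]
  congr 1
  refine adjoint_QtildeTower_apply_eq_of_eq_at L m n φ U _ _ x fun z hz => ?_
  have hzy : z = y := funext fun i => Fin.ext (by rw [← hz i, hxy i])
  subst hzy
  simp only [LinearMap.comp_apply, LinearEquiv.coe_coe, WL2.linearEquiv_symm_apply, Equiv.apply_symm_apply]
  refine QprimeTowerW_apply_eq_of_eqOn_fibre L m n φ U v (P z v) z fun x' hx' => ?_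
  rw [hP, if_pos hx']

variable (hRlev : ∀ j b w, ‖adTransportW φ (UlevOf L m (n + 1) U j) b w‖ ≤ ‖w‖)
include hRlev

/-- **(D-P) AT `k = n+1` LEVELS, BIG-BLOCK-LOCAL**: for `x` over `y`,
`‖((Δ′_{a′,k}(U) − Δ^η_U)v)(x)‖ ≤ |a′|·(c₁∕(c₀(L^{n+1})^d))·(√(c₀(L^{n+1})^d))⁻¹·‖1_{B^k(y)}v‖_{c₀}` for contractive level transporters.
[cite: Balaban1985BackgroundPropagators, (3.24) p.394, Thm 3.1 (3.42) p.397, (3.49) p.399] -/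
theorem norm_laplacePrimeAk_sub_covLaplace_apply_le_block (η a' : ℝ) (v : SiteL2K ℂ d (towerP L m (n + 1)) c₀ W)
    (x : TSite d (towerP L m (n + 1))) (y : TSite d m) (hxy : ∀ i, (x i : ℕ) / L ^ (n + 1) = (y i : ℕ)) :
    ‖WL2.equiv ℂ _ W (laplacePrimeAk L m n φ η U a' (c₁ := c₁) v -
        covLaplaceSiteK ((η : ℂ))⁻¹ (adTransportW φ U) (adTransportW φ fun b => (U b)⁻¹) v) x‖ ≤
      |a'| * (c₁ / (c₀ * ((L : ℝ) ^ (n + 1)) ^ d)) * (Real.sqrt (c₀ * ((L : ℝ) ^ (n + 1)) ^ d))⁻¹ * ‖P y v‖ := by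
  rw [equiv_laplacePrimeAk_sub_covLaplace_apply_eq_block L m n φ U hP η a' v x y hxy]
  exact norm_laplacePrimeAk_sub_covLaplace_apply_le L m n φ U hRlev (c₁ := c₁) η a' _ x

/-- **(D-P) AT `k` LEVELS ON THE DIAGONAL `c₀(L^{n+1})^d = c₁`**: `≤ (|a′|∕√c₁)·‖1_{B^k(y)}v‖_{c₀}` — LEVEL-FREE. [cite: Balaban1985BackgroundPropagators, (3.24) p.394, (3.42) p.397] -/
theorem norm_laplacePrimeAk_sub_covLaplace_apply_le_block_diagonal (hw : c₀ * ((L : ℝ) ^ (n + 1)) ^ d = c₁) (η a' : ℝ)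
    (v : SiteL2K ℂ d (towerP L m (n + 1)) c₀ W) (x : TSite d (towerP L m (n + 1))) (y : TSite d m)
    (hxy : ∀ i, (x i : ℕ) / L ^ (n + 1) = (y i : ℕ)) :
    ‖WL2.equiv ℂ _ W (laplacePrimeAk L m n φ η U a' (c₁ := c₁) v -
        covLaplaceSiteK ((η : ℂ))⁻¹ (adTransportW φ U) (adTransportW φ fun b => (U b)⁻¹) v) x‖ ≤
      |a'| * (Real.sqrt c₁)⁻¹ * ‖P y v‖ := by
  rw [equiv_laplacePrimeAk_sub_covLaplace_apply_eq_block L m n φ U hP η a' v x y hxy]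
  exact norm_laplacePrimeAk_sub_covLaplace_apply_le_diagonal L m n φ U hRlev (c₁ := c₁) hw η a' _ x

end Tower

/-! ## §3 The one-block masses: `‖1_{B}f‖_{c₀} ≤ √(c₀|B|)·sup_B‖f‖` — the `√μ` of the bootstrap (`μ = c₁` on the diagonal) -/

section Mass

variable {d : ℕ} (L : ℕ) [NeZero L] (m : Fin d → ℕ) {W : Type*} [NormedAddCommGroup W] [InnerProductSpace ℂ W] {c₀ : ℝ} [Fact (0 < c₀)]

/-- **ONE STEP: `‖P_y f‖_{c₀} ≤ √(c₀L^d)·F` if `‖f(x)‖ ≤ F` on `B(y)`** (`|B(y)| = L^d`); `= √c₁·F` on the diagonal `c₁ = L^d c₀` — the `hμ` letter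
(`‖f‖ ≤ √μ·F`, `μ = c₁`) of `B9Eq342GreenPrimeSupBound.norm_GpOfU_apply_le` for `f` supported in one unit block. [cite: Balaban1985BackgroundPropagators, (3.11) p.392, (3.42) p.397 «supp λ ⊂ Δ(y′)»] -/
theorem norm_block_le_sqrt_mul {P : TSite d m → SiteL2K ℂ d (fineP L m) c₀ W →L[ℂ] SiteL2K ℂ d (fineP L m) c₀ W}
    (hP : ∀ (y : TSite d m) (f : SiteL2K ℂ d (fineP L m) c₀ W) (x : TSite d (fineP L m)),
      WL2.equiv ℂ (fun _ : TSite d (fineP L m) => c₀) W (P y f) x =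
        if blockCoord L m x = y then WL2.equiv ℂ (fun _ : TSite d (fineP L m) => c₀) W f x else 0)
    (y : TSite d m) (f : SiteL2K ℂ d (fineP L m) c₀ W) {F : ℝ} (hF0 : 0 ≤ F)
    (hF : ∀ x, blockCoord L m x = y → ‖WL2.equiv ℂ (fun _ : TSite d (fineP L m) => c₀) W f x‖ ≤ F) :
    ‖P y f‖ ≤ Real.sqrt (c₀ * (L : ℝ) ^ d) * F := by
  have hc₀ : 0 < c₀ := Fact.out
  refine (pow_le_pow_iff_left₀ (norm_nonneg _) (by positivity) two_ne_zero).1 ?_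
  rw [WL2.norm_sq (𝕜 := ℂ) (w := fun _ : TSite d (fineP L m) => c₀) (V := W), mul_pow, Real.sq_sqrt (by positivity)]
  have hterm : ∀ x, (fun _ : TSite d (fineP L m) => c₀) x * ‖WL2.equiv ℂ (fun _ : TSite d (fineP L m) => c₀) W (P y f) x‖ ^ 2 =
      if blockCoord L m x = y then c₀ * ‖WL2.equiv ℂ (fun _ : TSite d (fineP L m) => c₀) W f x‖ ^ 2 else 0 := fun x => by
    rw [hP]; split_ifs <;> simp
  rw [Finset.sum_congr rfl fun x _ => hterm x, ← Finset.sum_filter]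
  calc ∑ x ∈ Finset.univ.filter (fun x => blockCoord L m x = y), c₀ * ‖WL2.equiv ℂ (fun _ : TSite d (fineP L m) => c₀) W f x‖ ^ 2
      ≤ ∑ _x ∈ Finset.univ.filter (fun x => blockCoord L m x = y), c₀ * F ^ 2 :=
        Finset.sum_le_sum fun x hx => mul_le_mul_of_nonneg_left
          (pow_le_pow_left₀ (norm_nonneg _) (hF x (Finset.mem_filter.1 hx).2) 2) hc₀.le
    _ = c₀ * (L : ℝ) ^ d * F ^ 2 := by
        rw [Finset.sum_const, nsmul_eq_mul, show Finset.univ.filter (fun x => blockCoord L m x = y) = B9Eq319QprimeTorus.blockOf L m y from rfl,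
          card_blockOf, Nat.cast_pow]
        ring

/-- **THE BIG BLOCKS HAVE `(L^d)^n` SITES**: `#{x ∈ T_{L^n m} : x_i ∕ L^n = y_i} = (L^d)^n` (induction: the fibrewise sum `sum_over_succ_eq` of
`B9Eq319QprimeTowerBlockLocal` with `|B(z)| = L^d`). [cite: Balaban1985Averaging, (2)–(4) pp.17–18; Balaban1985BackgroundPropagators, (3.15) p.393] -/
theorem card_fibre_eq : ∀ (n : ℕ) (y : TSite d m),
    ((Finset.univ.filter (fun x : TSite d (towerP L m n) => ∀ i, (x i : ℕ) / L ^ n = (y i : ℕ))).card : ℝ) = ((L : ℝ) ^ d) ^ n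
  | 0, y => by
    change ((Finset.univ.filter (fun x : TSite d m => ∀ i, (x i : ℕ) / L ^ 0 = (y i : ℕ))).card : ℝ) = ((L : ℝ) ^ d) ^ 0
    have h : Finset.univ.filter (fun x : TSite d m => ∀ i, (x i : ℕ) / L ^ 0 = (y i : ℕ)) = {y} := by
      ext x
      simp only [Finset.mem_filter, Finset.mem_univ, true_and, Finset.mem_singleton, pow_zero, Nat.div_one]
      exact ⟨fun h => funext fun i => Fin.ext (h i), fun h i => by rw [h]⟩
    rw [h, Finset.card_singleton, Nat.cast_one, pow_zero]
  | n + 1, y => by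
    have h : ∑ z ∈ Finset.univ.filter (fun z : TSite d (towerP L m n) => ∀ i, (z i : ℕ) / L ^ n = (y i : ℕ)),
          ∑ _x ∈ B9Eq319QprimeTorus.blockOf L (towerP L m n) z, (1 : ℝ) =
        ∑ _x ∈ Finset.univ.filter (fun x : TSite d (towerP L m (n + 1)) => ∀ i, (x i : ℕ) / L ^ (n + 1) = (y i : ℕ)), (1 : ℝ) :=
      sum_over_succ_eq L m n y (fun _ => (1 : ℝ))
    simp only [Finset.sum_const, nsmul_eq_mul, mul_one] at h
    have hb : ∀ z : TSite d (towerP L m n), ((B9Eq319QprimeTorus.blockOf L (towerP L m n) z).card : ℝ) = (L : ℝ) ^ d := fun z => by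
      rw [card_blockOf, Nat.cast_pow]
    rw [← h, Finset.sum_congr rfl fun z _ => hb z, Finset.sum_const, nsmul_eq_mul, card_fibre_eq n y, pow_succ]

/-- **`k = n+1` LEVELS: `‖P_y f‖_{c₀} ≤ √(c₀(L^{n+1})^d)·F` if `‖f(x)‖ ≤ F` over `y`**; `= √c₁·F` on the diagonal `c₀(L^{n+1})^d = c₁` — the `hμ` letter of
`B9Eq342GreenPrimeTowerSupBound.norm_GpOfUk_apply_le` for `f` supported in one unit block, LEVEL-FREE. [cite: Balaban1985BackgroundPropagators, (3.11) p.392, (3.42) p.397] -/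
theorem norm_block_le_sqrt_mul_tower (n : ℕ) {P : TSite d m → SiteL2K ℂ d (towerP L m (n + 1)) c₀ W →L[ℂ] SiteL2K ℂ d (towerP L m (n + 1)) c₀ W}
    (hP : ∀ (y : TSite d m) (f : SiteL2K ℂ d (towerP L m (n + 1)) c₀ W) (x : TSite d (towerP L m (n + 1))),
      WL2.equiv ℂ (fun _ : TSite d (towerP L m (n + 1)) => c₀) W (P y f) x =
        if (∀ i, (x i : ℕ) / L ^ (n + 1) = (y i : ℕ)) then WL2.equiv ℂ (fun _ : TSite d (towerP L m (n + 1)) => c₀) W f x else 0)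
    (y : TSite d m) (f : SiteL2K ℂ d (towerP L m (n + 1)) c₀ W) {F : ℝ} (hF0 : 0 ≤ F)
    (hF : ∀ x, (∀ i, (x i : ℕ) / L ^ (n + 1) = (y i : ℕ)) → ‖WL2.equiv ℂ (fun _ : TSite d (towerP L m (n + 1)) => c₀) W f x‖ ≤ F) :
    ‖P y f‖ ≤ Real.sqrt (c₀ * ((L : ℝ) ^ (n + 1)) ^ d) * F := by
  have hc₀ : 0 < c₀ := Fact.out
  refine (pow_le_pow_iff_left₀ (norm_nonneg _) (by positivity) two_ne_zero).1 ?_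
  rw [WL2.norm_sq (𝕜 := ℂ) (w := fun _ : TSite d (towerP L m (n + 1)) => c₀) (V := W), mul_pow, Real.sq_sqrt (by positivity)]
  have hterm : ∀ x, (fun _ : TSite d (towerP L m (n + 1)) => c₀) x * ‖WL2.equiv ℂ (fun _ : TSite d (towerP L m (n + 1)) => c₀) W (P y f) x‖ ^ 2 =
      if (∀ i, (x i : ℕ) / L ^ (n + 1) = (y i : ℕ)) then c₀ * ‖WL2.equiv ℂ (fun _ : TSite d (towerP L m (n + 1)) => c₀) W f x‖ ^ 2 else 0 :=
    fun x => by rw [hP]; split_ifs <;> simp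
  rw [Finset.sum_congr rfl fun x _ => hterm x, ← Finset.sum_filter]
  calc ∑ x ∈ Finset.univ.filter (fun x : TSite d (towerP L m (n + 1)) => ∀ i, (x i : ℕ) / L ^ (n + 1) = (y i : ℕ)),
          c₀ * ‖WL2.equiv ℂ (fun _ : TSite d (towerP L m (n + 1)) => c₀) W f x‖ ^ 2
      ≤ ∑ _x ∈ Finset.univ.filter (fun x : TSite d (towerP L m (n + 1)) => ∀ i, (x i : ℕ) / L ^ (n + 1) = (y i : ℕ)), c₀ * F ^ 2 :=
        Finset.sum_le_sum fun x hx => mul_le_mul_of_nonneg_left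
          (pow_le_pow_left₀ (norm_nonneg _) (hF x (Finset.mem_filter.1 hx).2) 2) hc₀.le
    _ = c₀ * ((L : ℝ) ^ (n + 1)) ^ d * F ^ 2 := by
        rw [Finset.sum_const, nsmul_eq_mul, card_fibre_eq L m (n + 1) y, ← pow_mul, ← pow_mul, Nat.mul_comm d (n + 1)]
        ring

end Mass

end Literature.MathematicalPhysics.QuantumFieldTheory.Balaban1983to89.B9Eq324PenaltyBlockLocal

end
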